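import Literature.AlgebraicGeometry.Resolution.PlanePointBlowupLocal
import Mathlib.AlgebraicGeometry.ResidueField
import HarnessLib

/-!
# Chart transfer: a `K`-rational point of the blow-up over a point with a plane chart has a plane chart again

Topic: `Literature/AlgebraicGeometry/Resolution`. Companion of `PlanePointBlowupAmbient.lean` / `PlanePointBlowupLocal.lean`.
Let `f : Z → Spec K` (ANY field `K`), `x₀ ∈ Z` a closed point with a plane chart `(V, e : V ≅ 𝔸²_K over K, e x₀ = 0)`
and `π : W → Z` a blowing up along `𝓘_{x₀}`. For a point `x₁ ∈ W` over `x₀` which is `K`-RATIONAL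
(`IsIso (W.fromSpecResidueField x₁ ≫ π ≫ f)`) we construct a plane chart of `π ≫ f` at `x₁`:

* `exists_iso_P_of_chartEquiv` — an affine open `U` of a `K`-scheme `g : Y → Spec K` whose coordinate ring is `K[s,t]`
  COMPATIBLY WITH `K` (`Φ ∘ g^*|_U ∘ ε⁻¹ = algebraMap`, the shape delivered by
  `PlanePointBlowupAmbient.exists_appLE_comp_eq`) is isomorphic to `𝔸²_K` OVER `K` (`IsAffineOpen.isoSpec`, `Spec` of the
  ring isomorphism, `ext_of_isAffine`);
* `isIso_fromSpecResidueField_comp_iff_of_isOpenImmersion` — `K`-rationality is invariant under open immersions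
  (residue fields do not change);
* `exists_translate` — a `K`-rational point of `𝔸²_K` is moved to the origin by a `K`-automorphism of `𝔸²_K` (the
  translation `Xᵢ ↦ Xᵢ − cᵢ`, `cᵢ` the coordinates of the point read off the section `Spec K → 𝔸²_K` through it);
* **`hasPlaneChart_of_over`** — the chart transfer itself: `x₁` lies in one of the two affine-plane charts of the blown-up
  plane over `V` (`PlanePointBlowupAmbient.chart_sup_chart`), that chart is `𝔸²_K` over `K`, and a translation centres it
  at `x₁`.

WHY (cell res-hironaka, LADDER-RESOLUTION rung L, slot W4.6): with `PlanePointBlowupLocal.smooth_comp_of_hasPlaneChart` this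
closes the induction «every stage of the cusp staircase over an ARBITRARY field `K` is an ambient datum and its singular
point has a plane chart» (campaign file `…CuspStaircaseAllFields.lean`). No perfectness of `K` anywhere.

## References

* U. Görtz, T. Wedhorn, *Algebraic Geometry I* (2nd ed. 2020), Prop. 13.91; (13.19) p. 413. [cite: GortzWedhorn2020, Prop. 13.91]
* The Stacks Project, Tags 0804, 01J7. [cite: StacksProject, Tag 0804]
-/

noncomputable section

set_option backward.isDefEq.respectTransparency false

open CategoryTheory AlgebraicGeometry TopologicalSpace Opposite MvPolynomial

namespace Literature.AlgebraicGeometry.Resolution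

namespace PlanePointBlowup

open Scheme.IdealSheafData

universe u

variable {K : Type u} [Field K]

/-! ## An affine open with coordinate ring `K[s,t]` over `K` is `𝔸²_K` over `K` -/

/-- **An affine open `U` of a `K`-scheme whose coordinate ring is `K[s,t]` compatibly with `K` is isomorphic to `𝔸²_K`
OVER `K`.** [cite: GortzWedhorn2020, (13.19) p. 413] -/
theorem exists_iso_P_of_chartEquiv {Y : Scheme.{u}} (g : Y ⟶ Spec (.of K)) {U : Y.Opens} (hU : IsAffineOpen U)
    (Φ : Γ(Y, U) ≃+* B K)
    (hΦ : ((Φ : Γ(Y, U) →+* B K).comp ((g.appLE ⊤ U le_top).hom)).comp ((ε K).symm : K →+* Γ(Spec (.of K), ⊤)) =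
      algebraMap K (B K)) :
    ∃ e₂ : (U : Scheme.{u}) ≅ P K, e₂.hom ≫ f K = U.ι ≫ g := by
  let ι₀ : CommRingCat.of (B K) ≅ Γ(Y, U) := Φ.symm.toCommRingCatIso
  let e₂ : (U : Scheme.{u}) ≅ P K := hU.isoSpec ≪≫ Scheme.Spec.mapIso ι₀.op
  refine ⟨e₂, ?_⟩
  apply AlgebraicGeometry.ext_of_isAffine
  apply CommRingCat.hom_ext
  apply RingHom.ext
  intro x
  obtain ⟨c, rfl⟩ : ∃ c : K, x = (ε K).symm c := ⟨ε K x, ((ε K).symm_apply_apply x).symm⟩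
  -- the right-hand side: restriction of `g^*` to `U`
  have hR : ((U.ι ≫ g).appTop).hom ((ε K).symm c) = U.topIso.inv ((g.appLE ⊤ U le_top).hom ((ε K).symm c)) := by
    rw [Scheme.Hom.comp_appTop, CommRingCat.hom_comp, RingHom.comp_apply, Scheme.Opens.ι_appTop,
      Scheme.Hom.appLE, CommRingCat.hom_comp, RingHom.comp_apply, Scheme.Opens.topIso_inv]
    change _ = (Y.presheaf.map _ ≫ Y.presheaf.map _).hom ((g.app ⊤).hom _)
    rw [← Y.presheaf.map_comp]
    rfl
  -- the left-hand side: through `Spec K[s,t]` and `Spec Γ(Y,U)`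
  have h1 : ((f K).appTop).hom ((ε K).symm c) = (γ K).symm (algebraMap K (A K) c) := appTop_f_apply (K := K) c
  have h2 : ((Spec.map ι₀.hom).appTop).hom ((γ K).symm (algebraMap K (A K) c)) =
      (Scheme.ΓSpecIso Γ(Y, U)).inv.hom (Φ.symm (algebraMap K (B K) c)) := by
    have h := congrArg (fun F => CommRingCat.Hom.hom F (algebraMap K (B K) c)) (Scheme.ΓSpecIso_inv_naturality ι₀.hom)
    simp only [CommRingCat.hom_comp, RingHom.comp_apply] at h
    rw [γ_symm_apply]
    exact h.symm
  have h3 : (hU.isoSpec.hom.appTop).hom ((Scheme.ΓSpecIso Γ(Y, U)).inv.hom (Φ.symm (algebraMap K (B K) c))) =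
      U.topIso.inv (Φ.symm (algebraMap K (B K) c)) := by
    rw [IsAffineOpen.isoSpec_hom_appTop]
    change U.topIso.inv ((Scheme.ΓSpecIso Γ(Y, U)).hom ((Scheme.ΓSpecIso Γ(Y, U)).inv (Φ.symm (algebraMap K (B K) c)))) = _
    rw [Iso.inv_hom_id_apply]
  have hΦc : (g.appLE ⊤ U le_top).hom ((ε K).symm c) = Φ.symm (algebraMap K (B K) c) := by
    have h := congrArg (fun F : K →+* B K => F c) hΦ
    simp only [RingHom.comp_apply, RingEquiv.coe_toRingHom] at h
    rw [← h, RingEquiv.symm_apply_apply]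
  change ((e₂.hom ≫ f K).appTop).hom ((ε K).symm c) = ((U.ι ≫ g).appTop).hom ((ε K).symm c)
  rw [hR, hΦc]
  change (((hU.isoSpec.hom ≫ Spec.map ι₀.hom) ≫ f K).appTop).hom ((ε K).symm c) = _
  rw [Scheme.Hom.comp_appTop, Scheme.Hom.comp_appTop, CommRingCat.hom_comp, CommRingCat.hom_comp, RingHom.comp_apply,
    RingHom.comp_apply, h1, h2, h3]

/-! ## `K`-rationality along open immersions -/

/-- **`K`-rationality does not change along an open immersion** (the residue field does not change).
[cite: StacksProject, Tag 01J7] -/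
theorem isIso_fromSpecResidueField_comp_iff_of_isOpenImmersion {X Y : Scheme.{u}} (j : X ⟶ Y) [IsOpenImmersion j]
    (h : Y ⟶ Spec (.of K)) (x : X) :
    IsIso (X.fromSpecResidueField x ≫ j ≫ h) ↔ IsIso (Y.fromSpecResidueField (j x) ≫ h) := by
  have heq : X.fromSpecResidueField x ≫ j ≫ h = Spec.map (j.residueFieldMap x) ≫ Y.fromSpecResidueField (j x) ≫ h := by
    rw [← Scheme.Hom.SpecMap_residueFieldMap_fromSpecResidueField_assoc]
  rw [heq]
  constructor
  · intro hiso
    have : Y.fromSpecResidueField (j x) ≫ h = inv (Spec.map (j.residueFieldMap x)) ≫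
        (Spec.map (j.residueFieldMap x) ≫ Y.fromSpecResidueField (j x) ≫ h) := by
      rw [IsIso.inv_hom_id_assoc]
    rw [this]
    infer_instance
  · intro hiso
    infer_instance

/-! ## Translations of the plane -/

/-- The translation `Xᵢ ↦ Xᵢ + cᵢ` as a `K`-algebra automorphism of `K[x₀,x₁]` (inverse `Xᵢ ↦ Xᵢ − cᵢ`). [folklore] -/
def translateEquiv (c : Fin 2 → K) : A K ≃ₐ[K] A K :=
  AlgEquiv.ofAlgHom (aeval fun i => X i + C (c i)) (aeval fun i => X i - C (c i))
    (by
      refine MvPolynomial.algHom_ext fun i => ?_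
      simp only [AlgHom.comp_apply, aeval_X, map_sub, aeval_C, AlgHom.id_apply]
      rw [MvPolynomial.algebraMap_eq, add_sub_cancel_right])
    (by
      refine MvPolynomial.algHom_ext fun i => ?_
      simp only [AlgHom.comp_apply, aeval_X, map_add, aeval_C, AlgHom.id_apply]
      rw [MvPolynomial.algebraMap_eq, sub_add_cancel])

/-- `translateEquiv c (Xᵢ) = Xᵢ + cᵢ`. [cite: StacksProject, Tag 01J7] -/
@[simp] theorem translateEquiv_X (c : Fin 2 → K) (i : Fin 2) : translateEquiv c (X i) = X i + C (c i) := by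
  simp [translateEquiv]

/-- **A `K`-rational point of `𝔸²_K` is a translate of the origin**: if `Spec κ(z) → 𝔸²_K → Spec K` is an isomorphism there
is a `K`-automorphism `τ` of `𝔸²_K` (`τ ≫ f = f`) with `τ z = origin`. [cite: StacksProject, Tag 01J7] -/
theorem exists_translate (z : P K) [IsIso ((P K).fromSpecResidueField z ≫ f K)] :
    ∃ τ : P K ≅ P K, τ.hom ≫ f K = f K ∧ τ.hom.base z = ξ K := by
  -- the section through `z`
  let s : Spec (.of K) ⟶ P K := inv ((P K).fromSpecResidueField z ≫ f K) ≫ (P K).fromSpecResidueField z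
  have hs : s ≫ f K = 𝟙 _ := by
    simp only [s, Category.assoc, IsIso.inv_hom_id]
  have hsz : ∀ t, s.base t = z := fun t => by
    simp only [s, Scheme.Hom.comp_base, TopCat.comp_app]
    exact Scheme.fromSpecResidueField_apply z _
  -- it is `Spec` of a `K`-algebra map `ψ : K[x₀,x₁] → K`
  obtain ⟨ψ, hψ⟩ := Spec.map_surjective s
  have hψalg : ∀ c : K, ψ.hom (algebraMap K (A K) c) = c := fun c => by
    have h1 : Spec.map (CommRingCat.ofHom (algebraMap K (A K)) ≫ ψ) = 𝟙 _ := by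
      rw [Spec.map_comp, hψ]
      exact hs
    rw [← Spec.map_id] at h1
    have h2 := congrArg (fun F => CommRingCat.Hom.hom F c) (Spec.map_injective h1)
    simpa using h2
  let ψa : A K →ₐ[K] K := { ψ.hom with commutes' := hψalg }
  -- the translation by the coordinates of `z`
  let c : Fin 2 → K := fun i => ψ.hom (X i)
  let σ : A K ≃ₐ[K] A K := (translateEquiv c).symm
  have hσX : ∀ i, σ (X i) = X i - C (c i) := fun i => by
    apply (translateEquiv c).injective
    rw [AlgEquiv.apply_symm_apply, map_sub, translateEquiv_X]
    have hC : translateEquiv c (C (c i)) = C (c i) := (translateEquiv c).commutes (c i)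
    rw [hC, add_sub_cancel_right]
  have hψσ : ψa.comp (σ : A K →ₐ[K] A K) = aeval (0 : Fin 2 → K) := by
    refine MvPolynomial.algHom_ext fun i => ?_
    change ψa (σ (X i)) = aeval (0 : Fin 2 → K) (X i)
    rw [hσX, map_sub, aeval_X]
    have hC : ψa (C (c i)) = c i := ψa.commutes (c i)
    rw [hC]
    exact sub_self _
  -- `τ = Spec σ`
  let ισ : CommRingCat.of (A K) ≅ CommRingCat.of (A K) := σ.toRingEquiv.toCommRingCatIso
  let τ : P K ≅ P K := Scheme.Spec.mapIso ισ.op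
  refine ⟨τ, ?_, ?_⟩
  · -- over `K`
    change Spec.map ισ.hom ≫ Spec.map (CommRingCat.ofHom (algebraMap K (A K))) = Spec.map _
    rw [← Spec.map_comp]
    congr 1
    apply CommRingCat.hom_ext
    apply RingHom.ext
    intro a
    change σ (algebraMap K (A K) a) = algebraMap K (A K) a
    exact σ.commutes a
  · -- `τ z = origin`
    have hz : z = s.base (⊥ : PrimeSpectrum K) := (hsz _).symm
    rw [hz, ← hψ]
    apply PrimeSpectrum.ext
    change Ideal.comap σ.toRingEquiv.toRingHom (Ideal.comap ψ.hom (⊥ : PrimeSpectrum K).asIdeal) = originIdeal K 2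
    rw [Ideal.comap_comap]
    have hbot : (⊥ : PrimeSpectrum K).asIdeal = ⊥ := rfl
    rw [hbot, ← RingHom.ker_eq_comap_bot]
    have hcomp : ψ.hom.comp σ.toRingEquiv.toRingHom = (aeval (0 : Fin 2 → K) : A K →ₐ[K] K).toRingHom := by
      have := congrArg AlgHom.toRingHom hψσ
      exact this
    rw [hcomp]
    ext g
    rw [RingHom.mem_ker, mem_originIdeal_iff]
    change aeval (0 : Fin 2 → K) g = 0 ↔ _
    rw [MvPolynomial.aeval_zero]
    rfl

/-! ## The chart transfer -/

section Transfer

variable {Z : Scheme.{u}} {f : Z ⟶ Spec (.of K)} {x₀ : Z} {V : Z.Opens} {W : Scheme.{u}} {π : W ⟶ Z}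

/-- **CHART TRANSFER.** Let `x₀ ∈ Z` be closed with a plane chart `(V, e)` over `K`, `π : W → Z` a blowing up along `𝓘_{x₀}`
and `x₁ ∈ W` a point over `x₀` that is `K`-rational for `π ≫ f`. Then `x₁` has a plane chart for `π ≫ f`: it lies in one
of the two affine-plane charts of the blown-up plane over `V`, which is `𝔸²_K` over `K`, re-centred at `x₁` by a
translation. [cite: GortzWedhorn2020, Prop. 13.91] -/
theorem hasPlaneChart_of_over (hx₀ : IsClosed ({x₀} : Set Z)) (hx₀V : x₀ ∈ V) (e : (V : Scheme.{u}) ≅ P K)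
    (he : e.hom ≫ PlanePointBlowup.f K = V.ι ≫ f) (hex₀ : e.hom.base ⟨x₀, hx₀V⟩ = ξ K)
    (hπ : IsBlowup π (vanishingIdeal (⟨{x₀}, hx₀⟩ : Closeds Z))) {x₁ : W} (hπx : π.base x₁ = x₀)
    [IsIso (W.fromSpecResidueField x₁ ≫ π ≫ f)] : HasPlaneChart (π ≫ f) x₁ := by
  -- the blown-up plane over the chart
  have hb : IsBlowup ((π ∣_ V) ≫ e.hom) (𝓘 K) := isBlowup_restrict_comp_chart hx₀ hx₀V e hex₀ hπ
  have hx₁V : x₁ ∈ π ⁻¹ᵁ V := by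
    show π.base x₁ ∈ (V : Set Z)
    rw [hπx]; exact hx₀V
  let x₁' : (↑(π ⁻¹ᵁ V) : Scheme.{u}) := ⟨x₁, hx₁V⟩
  -- `x₁` lies in one of the two charts
  obtain ⟨i, hi⟩ : ∃ i : Fin 2, x₁' ∈ chart ((π ∣_ V) ≫ e.hom) i := by
    have h : x₁' ∈ (⊤ : (↑(π ⁻¹ᵁ V) : Scheme.{u}).Opens) := trivial
    rw [← chart_sup_chart hb] at h
    rcases h with h | h
    · exact ⟨0, h⟩
    · exact ⟨1, h⟩
  obtain ⟨j, hij⟩ : ∃ j : Fin 2, i ≠ j := by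
    fin_cases i
    · exact ⟨1, by decide⟩
    · exact ⟨0, by decide⟩
  let U : (↑(π ⁻¹ᵁ V) : Scheme.{u}).Opens := chart ((π ∣_ V) ≫ e.hom) i
  have hU : IsAffineOpen U := isAffineOpen_chart hb i
  -- its coordinate ring is `K[s,t]` over `K`
  obtain ⟨Φ, hΦ⟩ := exists_appLE_comp_eq hb hij
  obtain ⟨e₂, he₂⟩ := exists_iso_P_of_chartEquiv (((π ∣_ V) ≫ e.hom) ≫ PlanePointBlowup.f K) hU Φ hΦ
  -- the open immersion `U ↪ W` and its compatibility with `K`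
  let jW : (U : Scheme.{u}) ⟶ W := U.ι ≫ (π ⁻¹ᵁ V).ι
  have hjW : jW ≫ π ≫ f = e₂.hom ≫ PlanePointBlowup.f K := by
    rw [he₂]
    simp only [jW, Category.assoc]
    congr 1
    rw [← Category.assoc ((π ⁻¹ᵁ V).ι), ← morphismRestrict_ι, Category.assoc, ← he]
  -- `z = e₂ x₁'` is `K`-rational in `𝔸²_K`
  let x₁'' : (U : Scheme.{u}) := ⟨x₁', hi⟩
  have hjx : jW.base x₁'' = x₁ := rfl
  haveI : IsIso ((U : Scheme.{u}).fromSpecResidueField x₁'' ≫ e₂.hom ≫ PlanePointBlowup.f K) := by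
    rw [← hjW]
    have h := (isIso_fromSpecResidueField_comp_iff_of_isOpenImmersion jW (π ≫ f) x₁'').mpr
    rw [hjx] at h
    exact h inferInstance
  haveI : IsIso ((P K).fromSpecResidueField (e₂.hom.base x₁'') ≫ PlanePointBlowup.f K) :=
    (isIso_fromSpecResidueField_comp_iff_of_isOpenImmersion e₂.hom (PlanePointBlowup.f K) x₁'').mp inferInstance
  -- translate to the origin
  obtain ⟨τ, hτ, hτz⟩ := exists_translate (e₂.hom.base x₁'')
  -- the chart of `W`: the image `V′ = U ↪ W` with `e′ = (U ≅ V′)⁻¹ ≫ e₂ ≫ τ`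
  let V' : W.Opens := (π ⁻¹ᵁ V).ι ''ᵁ U
  let eI : (U : Scheme.{u}) ≅ (V' : Scheme.{u}) := ((π ⁻¹ᵁ V).ι).isoImage U
  have hx₁V' : x₁ ∈ V' := by
    show x₁ ∈ (π ⁻¹ᵁ V).ι.base '' (U : Set (↑(π ⁻¹ᵁ V) : Scheme.{u}))
    exact ⟨x₁', hi, rfl⟩
  have hI : eI.inv ≫ jW = V'.ι := ((π ⁻¹ᵁ V).ι).isoImage_inv_ι U
  refine ⟨V', hx₁V', eI.symm ≪≫ e₂ ≪≫ τ, ?_, ?_⟩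
  · -- over `K`
    change (eI.inv ≫ e₂.hom ≫ τ.hom) ≫ PlanePointBlowup.f K = V'.ι ≫ π ≫ f
    rw [Category.assoc, Category.assoc, hτ, ← hjW, ← Category.assoc, hI]
  · -- centred at `x₁`
    change (eI.inv ≫ e₂.hom ≫ τ.hom).base ⟨x₁, hx₁V'⟩ = ξ K
    have hinv : eI.inv.base ⟨x₁, hx₁V'⟩ = x₁'' := by
      have hinj : Function.Injective jW.base := jW.isOpenEmbedding.injective
      apply hinj
      have h := congrArg (fun F : (V' : Scheme.{u}) ⟶ W => F.base ⟨x₁, hx₁V'⟩) hI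
      simp only [Scheme.Hom.comp_base, TopCat.comp_app] at h
      rw [hjx, h]
      rfl
    rw [Scheme.Hom.comp_base, Scheme.Hom.comp_base, TopCat.comp_app, TopCat.comp_app, hinv, hτz]

end Transfer

end PlanePointBlowup

end Literature.AlgebraicGeometry.Resolution

end
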